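import Summits.AtomisticToContinuum.Crystallization.Theorems.OverbindingBudgetEnergyLayerTailH

/-!
# OverbindingBudget · decomp-a2c lens-4 g35 — part XXIII-Z₄: TAIL SHARPENING — the far-layer field at a height-adapted smear parameter (×5–9)

Helper file under `--supports stmt-AtomisticToContinuum-31280` (RDEF = `Theses.OverbindingBudget.RobustDefectLimitWindows`); closes nothing.

Part XXII-L's per-span bound `layerField ≥ −(22/7) P⁻⁴` (part K's smearing at parameter `ε = 1`, factor `(1+ε)³ = 8`, with `√G ≥ 67/100`
absorbed) and part XXII-M's TAIL-H allowance `22/(21 s₀³ h⁴)` pay about ten times the true far field: the SMEARED (continuum) field of a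
Lennard-Jones lattice layer at height `P` is `−π/(12 √G P⁴)·(1 + O(P⁻⁶))` (`√G = √(‖a‖²‖b‖² − ⟪a,b⟫²)` = cell area), i.e. `0.2618/(√G P⁴)`.
This file re-instantiates part K's `layerField_bounds` with a smear parameter ADAPTED TO THE HEIGHT and keeps the cell's own `√G`:

* §1 `layerField_ge_smear` — generic: `λ P² ≤ (1+ε)P² − (1+1/ε)(17/16)²` ⟹ `layerField ≥ −((1+ε)³π/(12 λ²))·(√G P⁴)⁻¹` and
  `|layerField| ≤ ((1+ε)³π/(8 λ²))·(√G P⁴)⁻¹`;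
* §2 ★ three instances with the cell's own `√G`: `P ≥ 8`: `−(2/5)/(√G P⁴)` (`ε = 1/5`; ratio to the smeared constant 1.53) · `P ≥ 15`:
  `−(1/3)/(√G P⁴)` (`ε = 1/10`; 1.27) · `P ≥ 30`: `−(3/10)/(√G P⁴)` (`ε = 1/20`; 1.15); and with `√G ≥ 67/100` (admissible cells, part L
  `gram_ge_of_cell`): `−(3/5) P⁻⁴`, `−(1/2) P⁻⁴`, `−(9/20) P⁻⁴` — versus part L's `22/7`: ×5.2 / ×6.3 / ×7.0 (×7.4 / ×8.9 / ×9.9 for the near-square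
  S-cells, `√G ≈ 0.94`, through the `√G`-explicit forms);
* §3 ★ ANALYTIC FAR ROWS for the window tables TAB-T / TAB-S (part U `AffineWindowBound`): on a window whose span-`s` lower height is
  `P_lo = (s+1)(3/8 + kω) ≥ 8` the constant pair `(α_s, β_s) = (−(2/5)/(√G P_lo⁴), 0)` (resp. `1/3` from `15`, `3/10` from `30`) is a valid row
  (`windowRow_far8/15/30`) — so the census certifies interval rows only for the spans `s < s♯` and fills `s♯ ≤ s < s₀` with THEOREM rows at zero
  cost, paying the table's hard-wired allowance `22/(21 s₀³ h_lo⁴)` at a table length `s₀` of its choosing (`s₀ = 200`, `h_lo = 0.69`: `6·10⁻⁷`);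
* §4 ★ TAIL-H SHARPENED: `LayerFieldTailSumH (17/16) (3/8) (23/20) s₀ (1/(5 s₀³))` for `s₀ ≥ 21` and `… (1/(6 s₀³))` for `s₀ ≥ 39` (vs part M's
  `22/(21 s₀³)`: ×5.2 / ×6.3), from §2 and part L's telescoping `Σ_{s ≥ s₀} (s+1)⁻⁴ ≤ 1/(3 s₀³)`.

Budget consequence (critic row 529 (B′), S branch): the tail LOSS (allowance minus true tail) behind an analytic-row threshold `s♯` is
`≈ (c − π/12)/(3 √G s♯³ h_lo⁴)`: `s♯ = 21, c = 1/3, √G = 0.94, h_lo = 0.69 → 1.2·10⁻⁵`; `s♯ = 30 → 4·10⁻⁶`; `s♯ ≥ 43 (c = 3/10) → < 10⁻⁶` — against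
`4·10⁻⁵` (`s₀ = 40`) for the `22/21` constant.  Sorry-free, standard axioms; no instances / notation declared.
-/

noncomputable section

namespace Summit.AtomisticToContinuum.Crystallization.Theorems.OverbindingBudgetEnergyLayerTailSharp

open Real Finset
open scoped RealInnerProductSpace
open Literature.MathematicalPhysics.StatisticalMechanics (lennardJones)
open Summit.AtomisticToContinuum.Crystallization.Theorems.ChartedPlanarOrderChunkFloor (E3)
open Summit.AtomisticToContinuum.Crystallization.Theorems.ChartedPlanarOrderPairModulus (gram_pos)
open Summit.AtomisticToContinuum.Crystallization.Theorems.OverbindingBudgetRegistryCut (IsUnitNormal)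
open Summit.AtomisticToContinuum.Crystallization.Theorems.OverbindingBudgetEnergyStraightening (layerField)
open Summit.AtomisticToContinuum.Crystallization.Theorems.OverbindingBudgetEnergyLayerTail (layerField_bounds)
open Summit.AtomisticToContinuum.Crystallization.Theorems.OverbindingBudgetEnergyLayerTailSum (gram_ge_of_cell cellRadius_le
  tsum_inv_pow_four_le)
open Summit.AtomisticToContinuum.Crystallization.Theorems.OverbindingBudgetEnergyLayerTailH (LayerFieldTailSumH)

/-! ## §1 The smear bound at a height-adapted parameter -/

/-- ★ generic sharpening of part K's `layerField_bounds` (cell radius `17/16`): if `λ P² ≤ (1+ε)P² − (1+1/ε)(17/16)²` (`ε, λ > 0`, `P² ≥ 1`,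
`P = ⟪v, n⟫`) then the span's field family is summable, `layerField a b v ≥ −((1+ε)³ π/(12 λ²))·(√G P⁴)⁻¹` and
`|layerField a b v| ≤ ((1+ε)³ π/(8 λ²))·(√G P⁴)⁻¹`, `G = ‖a‖²‖b‖² − ⟪a,b⟫²`. [this file] -/
theorem layerField_ge_smear {a b n v : E3} (hab : LinearIndependent ℝ ![a, b]) (hn : IsUnitNormal a b n)
    (ha : ‖a‖ ≤ 17 / 16) (hb : ‖b‖ ≤ 17 / 16) {ε lam P : ℝ} (hε : 0 < ε) (hlam : 0 < lam) (hP : ⟪v, n⟫ = P) (hP1 : 1 ≤ P ^ 2)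
    (hT : lam * P ^ 2 ≤ (1 + ε) * P ^ 2 - (1 + ε⁻¹) * (17 / 16) ^ 2) :
    Summable (fun ij : ℤ × ℤ => lennardJones ‖v + (((ij.1 : ℤ) : ℝ) • a + ((ij.2 : ℤ) : ℝ) • b)‖) ∧
      -((1 + ε) ^ 3 * π / (12 * lam ^ 2) * (Real.sqrt (‖a‖ ^ 2 * ‖b‖ ^ 2 - ⟪a, b⟫ ^ 2) * P ^ 4)⁻¹) ≤ layerField a b v ∧
      |layerField a b v| ≤ (1 + ε) ^ 3 * π / (8 * lam ^ 2) * (Real.sqrt (‖a‖ ^ 2 * ‖b‖ ^ 2 - ⟪a, b⟫ ^ 2) * P ^ 4)⁻¹ := by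
  have hsGpos : 0 < Real.sqrt (‖a‖ ^ 2 * ‖b‖ ^ 2 - ⟪a, b⟫ ^ 2) := Real.sqrt_pos.2 (gram_pos hab)
  have hP2pos : 0 < P ^ 2 := by linarith
  have hlamP : 0 < lam * P ^ 2 := mul_pos hlam hP2pos
  have hT2pos : 0 < (1 + ε) * P ^ 2 - (1 + ε⁻¹) * (17 / 16 : ℝ) ^ 2 := lt_of_lt_of_le hlamP hT
  have hT' : 0 < (1 + ε) * ⟪v, n⟫ ^ 2 - (1 + ε⁻¹) * (17 / 16 : ℝ) ^ 2 := by rw [hP]; exact hT2pos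
  have hP1' : 1 ≤ ⟪v, n⟫ ^ 2 := by rw [hP]; exact hP1
  obtain ⟨hS, hlo, habs⟩ := layerField_bounds hab hn hε (cellRadius_le ha hb) hT' hP1'
  rw [hP] at hlo habs
  set sG := Real.sqrt (‖a‖ ^ 2 * ‖b‖ ^ 2 - ⟪a, b⟫ ^ 2) with hsG
  set T2 := (1 + ε) * P ^ 2 - (1 + ε⁻¹) * (17 / 16 : ℝ) ^ 2 with hT2
  -- compare `π/(2 √G T₂²)` with `π/(2 λ²)·(√G P⁴)⁻¹`
  have hTsq : (lam * P ^ 2) ^ 2 ≤ T2 ^ 2 := pow_le_pow_left₀ hlamP.le hT 2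
  have hX : π / (2 * sG * T2 ^ 2) ≤ π / (2 * sG * (lam * P ^ 2) ^ 2) := by
    apply div_le_div_of_nonneg_left Real.pi_pos.le (by positivity)
    exact mul_le_mul_of_nonneg_left hTsq (by positivity)
  have e : π / (2 * sG * (lam * P ^ 2) ^ 2) = π / (2 * lam ^ 2) * (sG * P ^ 4)⁻¹ := by
    rw [div_eq_mul_inv, div_eq_mul_inv, mul_assoc π]
    congr 1
    rw [← mul_inv]
    congr 1
    ring
  rw [e] at hX
  have hε1 : 0 ≤ (1 + ε) ^ 3 := by positivity
  have hM := mul_le_mul_of_nonneg_left hX hε1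
  refine ⟨hS, ?_, ?_⟩
  · have e2 : (1 + ε) ^ 3 * π / (12 * lam ^ 2) * (sG * P ^ 4)⁻¹ = 1 / 6 * ((1 + ε) ^ 3 * (π / (2 * lam ^ 2) * (sG * P ^ 4)⁻¹)) := by
      rw [div_eq_mul_inv, div_eq_mul_inv, mul_inv, mul_inv]
      ring
    rw [e2]
    linarith
  · have e2 : (1 + ε) ^ 3 * π / (8 * lam ^ 2) * (sG * P ^ 4)⁻¹ = 1 / 4 * ((1 + ε) ^ 3 * (π / (2 * lam ^ 2) * (sG * P ^ 4)⁻¹)) := by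
      rw [div_eq_mul_inv, div_eq_mul_inv, mul_inv, mul_inv]
      ring
    rw [e2]
    linarith

/-! ## §2 ★ Three instances: heights `≥ 8`, `≥ 15`, `≥ 30` -/

/-- ★ `P ≥ 8` (`ε = 1/5`, `λ = 27/25`, `10π/81 ≤ 2/5`): summable, `layerField a b v ≥ −(2/5)·(√G P⁴)⁻¹`, `|layerField a b v| ≤ (3/5)·(√G P⁴)⁻¹`
— 1.53× the smeared constant `π/12`. [this file] -/
theorem layerField_far8 {a b n v : E3} (hab : LinearIndependent ℝ ![a, b]) (hn : IsUnitNormal a b n) (ha : ‖a‖ ≤ 17 / 16)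
    (hb : ‖b‖ ≤ 17 / 16) {P : ℝ} (hP : ⟪v, n⟫ = P) (h8 : 8 ≤ P) :
    Summable (fun ij : ℤ × ℤ => lennardJones ‖v + (((ij.1 : ℤ) : ℝ) • a + ((ij.2 : ℤ) : ℝ) • b)‖) ∧
      -(2 / 5 * (Real.sqrt (‖a‖ ^ 2 * ‖b‖ ^ 2 - ⟪a, b⟫ ^ 2) * P ^ 4)⁻¹) ≤ layerField a b v ∧
      |layerField a b v| ≤ 3 / 5 * (Real.sqrt (‖a‖ ^ 2 * ‖b‖ ^ 2 - ⟪a, b⟫ ^ 2) * P ^ 4)⁻¹ := by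
  have hP2 : 64 ≤ P ^ 2 := by nlinarith
  have hT : (27 / 25 : ℝ) * P ^ 2 ≤ (1 + 1 / 5) * P ^ 2 - (1 + (1 / 5 : ℝ)⁻¹) * (17 / 16) ^ 2 := by norm_num; nlinarith
  obtain ⟨hS, hlo, habs⟩ := layerField_ge_smear hab hn ha hb (by norm_num : (0 : ℝ) < 1 / 5) (by norm_num : (0 : ℝ) < 27 / 25) hP
    (by linarith) hT
  have hX : 0 < (Real.sqrt (‖a‖ ^ 2 * ‖b‖ ^ 2 - ⟪a, b⟫ ^ 2) * P ^ 4)⁻¹ := by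
    have := Real.sqrt_pos.2 (gram_pos hab)
    have hP0 : 0 < P := by linarith
    positivity
  have hc1 : (1 + 1 / 5 : ℝ) ^ 3 * π / (12 * (27 / 25) ^ 2) ≤ 2 / 5 := by
    rw [div_le_iff₀ (by norm_num)]; nlinarith [Real.pi_lt_d2]
  have hc2 : (1 + 1 / 5 : ℝ) ^ 3 * π / (8 * (27 / 25) ^ 2) ≤ 3 / 5 := by
    rw [div_le_iff₀ (by norm_num)]; nlinarith [Real.pi_lt_d2]
  refine ⟨hS, ?_, habs.trans (mul_le_mul_of_nonneg_right hc2 hX.le)⟩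
  linarith [mul_le_mul_of_nonneg_right hc1 hX.le]

/-- ★ `P ≥ 15` (`ε = 1/10`, `λ = 26/25`): summable, `layerField a b v ≥ −(1/3)·(√G P⁴)⁻¹`, `|layerField a b v| ≤ (1/2)·(√G P⁴)⁻¹` — 1.27× the
smeared constant. [this file] -/
theorem layerField_far15 {a b n v : E3} (hab : LinearIndependent ℝ ![a, b]) (hn : IsUnitNormal a b n) (ha : ‖a‖ ≤ 17 / 16)
    (hb : ‖b‖ ≤ 17 / 16) {P : ℝ} (hP : ⟪v, n⟫ = P) (h15 : 15 ≤ P) :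
    Summable (fun ij : ℤ × ℤ => lennardJones ‖v + (((ij.1 : ℤ) : ℝ) • a + ((ij.2 : ℤ) : ℝ) • b)‖) ∧
      -(1 / 3 * (Real.sqrt (‖a‖ ^ 2 * ‖b‖ ^ 2 - ⟪a, b⟫ ^ 2) * P ^ 4)⁻¹) ≤ layerField a b v ∧
      |layerField a b v| ≤ 1 / 2 * (Real.sqrt (‖a‖ ^ 2 * ‖b‖ ^ 2 - ⟪a, b⟫ ^ 2) * P ^ 4)⁻¹ := by
  have hP2 : 225 ≤ P ^ 2 := by nlinarith
  have hT : (26 / 25 : ℝ) * P ^ 2 ≤ (1 + 1 / 10) * P ^ 2 - (1 + (1 / 10 : ℝ)⁻¹) * (17 / 16) ^ 2 := by norm_num; nlinarith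
  obtain ⟨hS, hlo, habs⟩ := layerField_ge_smear hab hn ha hb (by norm_num : (0 : ℝ) < 1 / 10) (by norm_num : (0 : ℝ) < 26 / 25) hP
    (by linarith) hT
  have hX : 0 < (Real.sqrt (‖a‖ ^ 2 * ‖b‖ ^ 2 - ⟪a, b⟫ ^ 2) * P ^ 4)⁻¹ := by
    have := Real.sqrt_pos.2 (gram_pos hab)
    have hP0 : 0 < P := by linarith
    positivity
  have hc1 : (1 + 1 / 10 : ℝ) ^ 3 * π / (12 * (26 / 25) ^ 2) ≤ 1 / 3 := by
    rw [div_le_iff₀ (by norm_num)]; nlinarith [Real.pi_lt_d2]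
  have hc2 : (1 + 1 / 10 : ℝ) ^ 3 * π / (8 * (26 / 25) ^ 2) ≤ 1 / 2 := by
    rw [div_le_iff₀ (by norm_num)]; nlinarith [Real.pi_lt_d2]
  refine ⟨hS, ?_, habs.trans (mul_le_mul_of_nonneg_right hc2 hX.le)⟩
  linarith [mul_le_mul_of_nonneg_right hc1 hX.le]

/-- ★ `P ≥ 30` (`ε = 1/20`, `λ = 51/50`): summable, `layerField a b v ≥ −(3/10)·(√G P⁴)⁻¹`, `|layerField a b v| ≤ (9/20)·(√G P⁴)⁻¹` — 1.15× the
smeared constant. [this file] -/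
theorem layerField_far30 {a b n v : E3} (hab : LinearIndependent ℝ ![a, b]) (hn : IsUnitNormal a b n) (ha : ‖a‖ ≤ 17 / 16)
    (hb : ‖b‖ ≤ 17 / 16) {P : ℝ} (hP : ⟪v, n⟫ = P) (h30 : 30 ≤ P) :
    Summable (fun ij : ℤ × ℤ => lennardJones ‖v + (((ij.1 : ℤ) : ℝ) • a + ((ij.2 : ℤ) : ℝ) • b)‖) ∧
      -(3 / 10 * (Real.sqrt (‖a‖ ^ 2 * ‖b‖ ^ 2 - ⟪a, b⟫ ^ 2) * P ^ 4)⁻¹) ≤ layerField a b v ∧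
      |layerField a b v| ≤ 9 / 20 * (Real.sqrt (‖a‖ ^ 2 * ‖b‖ ^ 2 - ⟪a, b⟫ ^ 2) * P ^ 4)⁻¹ := by
  have hP2 : 900 ≤ P ^ 2 := by nlinarith
  have hT : (51 / 50 : ℝ) * P ^ 2 ≤ (1 + 1 / 20) * P ^ 2 - (1 + (1 / 20 : ℝ)⁻¹) * (17 / 16) ^ 2 := by norm_num; nlinarith
  obtain ⟨hS, hlo, habs⟩ := layerField_ge_smear hab hn ha hb (by norm_num : (0 : ℝ) < 1 / 20) (by norm_num : (0 : ℝ) < 51 / 50) hP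
    (by linarith) hT
  have hX : 0 < (Real.sqrt (‖a‖ ^ 2 * ‖b‖ ^ 2 - ⟪a, b⟫ ^ 2) * P ^ 4)⁻¹ := by
    have := Real.sqrt_pos.2 (gram_pos hab)
    have hP0 : 0 < P := by linarith
    positivity
  have hc1 : (1 + 1 / 20 : ℝ) ^ 3 * π / (12 * (51 / 50) ^ 2) ≤ 3 / 10 := by
    rw [div_le_iff₀ (by norm_num)]; nlinarith [Real.pi_lt_d2]
  have hc2 : (1 + 1 / 20 : ℝ) ^ 3 * π / (8 * (51 / 50) ^ 2) ≤ 9 / 20 := by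
    rw [div_le_iff₀ (by norm_num)]; nlinarith [Real.pi_lt_d2]
  refine ⟨hS, ?_, habs.trans (mul_le_mul_of_nonneg_right hc2 hX.le)⟩
  linarith [mul_le_mul_of_nonneg_right hc1 hX.le]

/-- `√G ≥ 67/100` for an admissible cell (part L `gram_ge_of_cell`: `G ≥ 9/20`), as `(√G P⁴)⁻¹ ≤ (100/67)·(P⁴)⁻¹`. [bookkeeping] -/
theorem inv_sqrtGram_mul_le {a b : E3} (hab : LinearIndependent ℝ ![a, b]) (ha : ‖a‖ ≤ 17 / 16) (hb : ‖b‖ ≤ 17 / 16)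
    (hlat : ∀ i j : ℤ, ((i : ℝ) • a + (j : ℝ) • b) ≠ 0 → 9 / 10 ≤ ‖(i : ℝ) • a + (j : ℝ) • b‖) {P : ℝ} (hP : 0 < P) :
    (Real.sqrt (‖a‖ ^ 2 * ‖b‖ ^ 2 - ⟪a, b⟫ ^ 2) * P ^ 4)⁻¹ ≤ 100 / 67 * (P ^ 4)⁻¹ := by
  have hG := gram_ge_of_cell hab ha hb hlat
  have hsGpos : 0 < Real.sqrt (‖a‖ ^ 2 * ‖b‖ ^ 2 - ⟪a, b⟫ ^ 2) := Real.sqrt_pos.2 (gram_pos hab)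
  have h67 : (67 / 100 : ℝ) ≤ Real.sqrt (‖a‖ ^ 2 * ‖b‖ ^ 2 - ⟪a, b⟫ ^ 2) := by
    rw [Real.le_sqrt' (by norm_num)]; nlinarith
  rw [mul_inv]
  refine mul_le_mul_of_nonneg_right ?_ (by positivity)
  rw [inv_le_comm₀ hsGpos (by norm_num), inv_div]
  exact h67

/-- `P ≥ 8` over an admissible cell (`√G ≥ 67/100`): `layerField a b v ≥ −(3/5) P⁻⁴`, `|layerField a b v| ≤ (9/10) P⁻⁴` (part L: `22/7`, `5`). [this file] -/
theorem layerField_far8' {a b n v : E3} (hab : LinearIndependent ℝ ![a, b]) (hn : IsUnitNormal a b n) (ha : ‖a‖ ≤ 17 / 16)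
    (hb : ‖b‖ ≤ 17 / 16) (hlat : ∀ i j : ℤ, ((i : ℝ) • a + (j : ℝ) • b) ≠ 0 → 9 / 10 ≤ ‖(i : ℝ) • a + (j : ℝ) • b‖) {P : ℝ}
    (hP : ⟪v, n⟫ = P) (h8 : 8 ≤ P) : -(3 / 5 * (P ^ 4)⁻¹) ≤ layerField a b v ∧ |layerField a b v| ≤ 9 / 10 * (P ^ 4)⁻¹ := by
  obtain ⟨-, hlo, habs⟩ := layerField_far8 hab hn ha hb hP h8
  have hinv := inv_sqrtGram_mul_le hab ha hb hlat (show (0 : ℝ) < P by linarith)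
  have hq : 0 < (P ^ 4)⁻¹ := by have hP0 : 0 < P := by linarith
                                positivity
  constructor
  · nlinarith
  · nlinarith

/-- `P ≥ 15` over an admissible cell: `layerField a b v ≥ −(1/2) P⁻⁴`, `|layerField a b v| ≤ (3/4) P⁻⁴`. [this file] -/
theorem layerField_far15' {a b n v : E3} (hab : LinearIndependent ℝ ![a, b]) (hn : IsUnitNormal a b n) (ha : ‖a‖ ≤ 17 / 16)
    (hb : ‖b‖ ≤ 17 / 16) (hlat : ∀ i j : ℤ, ((i : ℝ) • a + (j : ℝ) • b) ≠ 0 → 9 / 10 ≤ ‖(i : ℝ) • a + (j : ℝ) • b‖) {P : ℝ}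
    (hP : ⟪v, n⟫ = P) (h15 : 15 ≤ P) : -(1 / 2 * (P ^ 4)⁻¹) ≤ layerField a b v ∧ |layerField a b v| ≤ 3 / 4 * (P ^ 4)⁻¹ := by
  obtain ⟨-, hlo, habs⟩ := layerField_far15 hab hn ha hb hP h15
  have hinv := inv_sqrtGram_mul_le hab ha hb hlat (show (0 : ℝ) < P by linarith)
  have hq : 0 < (P ^ 4)⁻¹ := by have hP0 : 0 < P := by linarith
                                positivity
  constructor
  · nlinarith
  · nlinarith

/-- `P ≥ 30` over an admissible cell: `layerField a b v ≥ −(9/20) P⁻⁴`, `|layerField a b v| ≤ (7/10) P⁻⁴`. [this file] -/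
theorem layerField_far30' {a b n v : E3} (hab : LinearIndependent ℝ ![a, b]) (hn : IsUnitNormal a b n) (ha : ‖a‖ ≤ 17 / 16)
    (hb : ‖b‖ ≤ 17 / 16) (hlat : ∀ i j : ℤ, ((i : ℝ) • a + (j : ℝ) • b) ≠ 0 → 9 / 10 ≤ ‖(i : ℝ) • a + (j : ℝ) • b‖) {P : ℝ}
    (hP : ⟪v, n⟫ = P) (h30 : 30 ≤ P) : -(9 / 20 * (P ^ 4)⁻¹) ≤ layerField a b v ∧ |layerField a b v| ≤ 7 / 10 * (P ^ 4)⁻¹ := by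
  obtain ⟨-, hlo, habs⟩ := layerField_far30 hab hn ha hb hP h30
  have hinv := inv_sqrtGram_mul_le hab ha hb hlat (show (0 : ℝ) < P by linarith)
  have hq : 0 < (P ^ 4)⁻¹ := by have hP0 : 0 < P := by linarith
                                positivity
  constructor
  · nlinarith
  · nlinarith

/-! ## §3 ★ Analytic far rows for the window tables -/

/-- the height of `P • n + u` is `P` for a unit `n` and `u ⊥ n`. [bookkeeping] -/
theorem inner_smul_normal_add {n u : E3} (hn1 : ‖n‖ = 1) (hu : ⟪u, n⟫ = 0) (P : ℝ) : ⟪P • n + u, n⟫ = P := by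
  rw [inner_add_left, real_inner_smul_left, real_inner_self_eq_norm_sq, hn1, hu]; ring

/-- monotonicity of the allowance in the lower span height: `(√G P⁴)⁻¹ ≤ (√G P_lo⁴)⁻¹` for `0 < P_lo ≤ P`. [bookkeeping] -/
theorem inv_sqrtGram_pow_anti {a b : E3} (hab : LinearIndependent ℝ ![a, b]) {Plo P : ℝ} (hPlo : 0 < Plo) (hP : Plo ≤ P) :
    (Real.sqrt (‖a‖ ^ 2 * ‖b‖ ^ 2 - ⟪a, b⟫ ^ 2) * P ^ 4)⁻¹ ≤ (Real.sqrt (‖a‖ ^ 2 * ‖b‖ ^ 2 - ⟪a, b⟫ ^ 2) * Plo ^ 4)⁻¹ := by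
  have hsG := Real.sqrt_pos.2 (gram_pos hab)
  apply inv_anti₀ (by positivity)
  exact mul_le_mul_of_nonneg_left (pow_le_pow_left₀ hPlo.le hP 4) hsG.le

/-- ★ **ANALYTIC FAR ROW, `P_lo ≥ 8`**: for every span height `P ≥ P_lo` and lateral offset `u ⊥ n`, `−(2/5)/(√G P_lo⁴) ≤ layerField a b (P • n + u)`
— the constant window-table row `(α_s, β_s) = (−(2/5)/(√G P_lo⁴), 0)`, `P_lo = (s+1)(3/8 + kω)` (part U `AffineWindowBound`). [this file] -/
theorem windowRow_far8 {a b n : E3} (hab : LinearIndependent ℝ ![a, b]) (hn : IsUnitNormal a b n) (ha : ‖a‖ ≤ 17 / 16)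
    (hb : ‖b‖ ≤ 17 / 16) {Plo : ℝ} (h8 : 8 ≤ Plo) (P : ℝ) (hP : Plo ≤ P) (u : E3) (hu : ⟪u, n⟫ = 0) :
    -(2 / 5 * (Real.sqrt (‖a‖ ^ 2 * ‖b‖ ^ 2 - ⟪a, b⟫ ^ 2) * Plo ^ 4)⁻¹) ≤ layerField a b (P • n + u) := by
  obtain ⟨-, hlo, -⟩ := layerField_far8 hab hn ha hb (inner_smul_normal_add hn.1 hu P) (h8.trans hP)
  have hmono := inv_sqrtGram_pow_anti hab (show (0 : ℝ) < Plo by linarith) hP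
  linarith

/-- ★ **ANALYTIC FAR ROW, `P_lo ≥ 15`**: `−(1/3)/(√G P_lo⁴) ≤ layerField a b (P • n + u)` for `P ≥ P_lo`, `u ⊥ n`. [this file] -/
theorem windowRow_far15 {a b n : E3} (hab : LinearIndependent ℝ ![a, b]) (hn : IsUnitNormal a b n) (ha : ‖a‖ ≤ 17 / 16)
    (hb : ‖b‖ ≤ 17 / 16) {Plo : ℝ} (h15 : 15 ≤ Plo) (P : ℝ) (hP : Plo ≤ P) (u : E3) (hu : ⟪u, n⟫ = 0) :
    -(1 / 3 * (Real.sqrt (‖a‖ ^ 2 * ‖b‖ ^ 2 - ⟪a, b⟫ ^ 2) * Plo ^ 4)⁻¹) ≤ layerField a b (P • n + u) := by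
  obtain ⟨-, hlo, -⟩ := layerField_far15 hab hn ha hb (inner_smul_normal_add hn.1 hu P) (h15.trans hP)
  have hmono := inv_sqrtGram_pow_anti hab (show (0 : ℝ) < Plo by linarith) hP
  linarith

/-- ★ **ANALYTIC FAR ROW, `P_lo ≥ 30`**: `−(3/10)/(√G P_lo⁴) ≤ layerField a b (P • n + u)` for `P ≥ P_lo`, `u ⊥ n`. [this file] -/
theorem windowRow_far30 {a b n : E3} (hab : LinearIndependent ℝ ![a, b]) (hn : IsUnitNormal a b n) (ha : ‖a‖ ≤ 17 / 16)
    (hb : ‖b‖ ≤ 17 / 16) {Plo : ℝ} (h30 : 30 ≤ Plo) (P : ℝ) (hP : Plo ≤ P) (u : E3) (hu : ⟪u, n⟫ = 0) :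
    -(3 / 10 * (Real.sqrt (‖a‖ ^ 2 * ‖b‖ ^ 2 - ⟪a, b⟫ ^ 2) * Plo ^ 4)⁻¹) ≤ layerField a b (P • n + u) := by
  obtain ⟨-, hlo, -⟩ := layerField_far30 hab hn ha hb (inner_smul_normal_add hn.1 hu P) (h30.trans hP)
  have hmono := inv_sqrtGram_pow_anti hab (show (0 : ℝ) < Plo by linarith) hP
  linarith

/-! ## §4 ★ TAIL-H sharpened -/

/-- TAIL-H from a per-span bound: if every span at height `P ≥ P₀` over the admissible family has `−c P⁻⁴ ≤ layerField` and `|layerField| ≤ A P⁻⁴`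
(`c ≥ 0`) then `LayerFieldTailSumH (17/16) (3/8) (23/20) s₀ (c/(3 s₀³))` for every `s₀ ≥ 1` with `(s₀ + 1)·3/8 ≥ P₀` (part L's telescoping
`Σ_{s ≥ s₀} (s+1)⁻⁴ ≤ 1/(3 s₀³)`). [bookkeeping] -/
theorem tailSumH_of_spanBound {P₀ c A : ℝ} (hc : 0 ≤ c)
    (hspan : ∀ (a b n v : E3), LinearIndependent ℝ ![a, b] → ‖a‖ ≤ 17 / 16 → ‖b‖ ≤ 17 / 16 →
      (∀ i j : ℤ, ((i : ℝ) • a + (j : ℝ) • b) ≠ 0 → 9 / 10 ≤ ‖(i : ℝ) • a + (j : ℝ) • b‖) → IsUnitNormal a b n →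
      ∀ P : ℝ, ⟪v, n⟫ = P → P₀ ≤ P → -(c * (P ^ 4)⁻¹) ≤ layerField a b v ∧ |layerField a b v| ≤ A * (P ^ 4)⁻¹)
    (s₀ : ℕ) (hs₁ : 1 ≤ s₀) (hP₀ : P₀ ≤ ((s₀ : ℝ) + 1) * (3 / 8)) :
    LayerFieldTailSumH (17 / 16) (3 / 8) (23 / 20) s₀ (c / (3 * (s₀ : ℝ) ^ 3)) := by
  intro a b n hab ha hb hlat hn h hη₁ hη₂ v hv
  have hs₁' : (1 : ℝ) ≤ s₀ := by exact_mod_cast hs₁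
  have hh : 0 < h := by linarith
  have hPs : ∀ s : ℕ, ⟪v (s + s₀), n⟫ = ((s : ℝ) + s₀ + 1) * h := by
    intro s; rw [hv (s + s₀)]; push_cast; ring
  have hP0 : ∀ s : ℕ, P₀ ≤ ((s : ℝ) + s₀ + 1) * h := by
    intro s
    have hs0 : (0 : ℝ) ≤ s := s.cast_nonneg
    have h1 : ((s₀ : ℝ) + 1) * (3 / 8) ≤ ((s : ℝ) + s₀ + 1) * h := by nlinarith
    exact hP₀.trans h1
  have hspan' := fun s : ℕ => hspan a b n (v (s + s₀)) hab ha hb hlat hn _ (hPs s) (hP0 s)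
  obtain ⟨hf, hfle⟩ := tsum_inv_pow_four_le hs₁'
  have hh4pos : 0 < (h ^ 4)⁻¹ := by positivity
  have epow : ∀ s : ℕ, ((((s : ℝ) + s₀ + 1) * h) ^ 4)⁻¹ = (h ^ 4)⁻¹ * ((((s : ℝ) + s₀ + 1)) ^ 4)⁻¹ := by
    intro s; rw [mul_pow, mul_inv]; ring
  have hshift : Summable (fun s : ℕ => layerField a b (v (s + s₀))) := by
    refine Summable.of_norm_bounded ((hf.mul_left (A * (h ^ 4)⁻¹))) (fun s => ?_)
    rw [Real.norm_eq_abs]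
    refine ((hspan' s).2).trans_eq ?_
    rw [epow s]; ring
  refine ⟨(summable_nat_add_iff s₀).1 hshift, ?_⟩
  have hlow : ∀ s : ℕ, -(c * (h ^ 4)⁻¹) * ((((s : ℝ) + s₀ + 1)) ^ 4)⁻¹ ≤ layerField a b (v (s + s₀)) := by
    intro s
    refine le_of_eq_of_le ?_ (hspan' s).1
    rw [epow s]; ring
  have h1 := Summable.tsum_le_tsum hlow (hf.mul_left _) hshift
  rw [tsum_mul_left] at h1
  have hprod : (h ^ 4)⁻¹ * ∑' i : ℕ, (((i : ℝ) + s₀ + 1) ^ 4)⁻¹ ≤ (h ^ 4)⁻¹ * (3 * (s₀ : ℝ) ^ 3)⁻¹ :=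
    mul_le_mul_of_nonneg_left hfle hh4pos.le
  have e : c / (3 * (s₀ : ℝ) ^ 3) * (h ^ 4)⁻¹ = c * ((h ^ 4)⁻¹ * (3 * (s₀ : ℝ) ^ 3)⁻¹) := by
    rw [div_eq_mul_inv]; ring
  rw [e]
  nlinarith [mul_le_mul_of_nonneg_left hprod hc]

/-- ★★ **TAIL-H SHARPENED (×5.2)**: `LayerFieldTailSumH (17/16) (3/8) (23/20) s₀ (1/(5 s₀³))` for every `s₀ ≥ 21` (span heights `≥ 22·3/8 > 8`;
per span `−(3/5) P⁻⁴`): allowance `0.2/(s₀³ h⁴)` — at `h = 0.78`: `s₀ = 30 → 2.0·10⁻⁵`, `s₀ = 40 → 8.4·10⁻⁶`, `s₀ = 60 → 2.5·10⁻⁶`. [this file] -/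
theorem layerFieldTailSumH_sharp (s₀ : ℕ) (hs₀ : 21 ≤ s₀) : LayerFieldTailSumH (17 / 16) (3 / 8) (23 / 20) s₀ (1 / (5 * (s₀ : ℝ) ^ 3)) := by
  have hs₀' : (21 : ℝ) ≤ s₀ := by exact_mod_cast hs₀
  have key := tailSumH_of_spanBound (P₀ := 8) (c := 3 / 5) (A := 9 / 10) (by norm_num)
    (fun a b n v hab ha hb hlat hn P hP hP₀ => layerField_far8' hab hn ha hb hlat hP hP₀) s₀ (by omega) (by nlinarith)
  have e : (3 / 5 : ℝ) / (3 * (s₀ : ℝ) ^ 3) = 1 / (5 * (s₀ : ℝ) ^ 3) := by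
    rw [div_div, show (5 : ℝ) * (3 * (s₀ : ℝ) ^ 3) = 3 * (5 * (s₀ : ℝ) ^ 3) by ring, div_mul_cancel_left₀ three_ne_zero, one_div]
  rw [e] at key
  exact key

/-- ★★ **TAIL-H SHARPENED (×6.3)**: `LayerFieldTailSumH (17/16) (3/8) (23/20) s₀ (1/(6 s₀³))` for every `s₀ ≥ 39` (span heights `≥ 15`; per span
`−(1/2) P⁻⁴`). [this file] -/
theorem layerFieldTailSumH_sharp' (s₀ : ℕ) (hs₀ : 39 ≤ s₀) : LayerFieldTailSumH (17 / 16) (3 / 8) (23 / 20) s₀ (1 / (6 * (s₀ : ℝ) ^ 3)) := by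
  have hs₀' : (39 : ℝ) ≤ s₀ := by exact_mod_cast hs₀
  have key := tailSumH_of_spanBound (P₀ := 15) (c := 1 / 2) (A := 3 / 4) (by norm_num)
    (fun a b n v hab ha hb hlat hn P hP hP₀ => layerField_far15' hab hn ha hb hlat hP hP₀) s₀ (by omega) (by nlinarith)
  have e : (1 / 2 : ℝ) / (3 * (s₀ : ℝ) ^ 3) = 1 / (6 * (s₀ : ℝ) ^ 3) := by
    rw [div_div]; congr 1; ring
  rw [e] at key
  exact key

end Summit.AtomisticToContinuum.Crystallization.Theorems.OverbindingBudgetEnergyLayerTailSharp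

end
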